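import Summits.PneNP.PneNP.Theses.KarlinRubin
import Summits.PneNP.PneNP.Theorems.MonotoneBlind.Negative.LoadBearing
import Literature.Computability.Complexity.RossmanMonotoneClique

/-!
# Strategy census (Lean side) — crux stmt-PneNP-18027 `MonotoneBlind` (route PneNP/KarlinRubin, crux #3)

Crux-strategist `planner-cstrat-stmt-PneNP-18027-b1-0`, 2026-08-17, pass 1. Companion of
`Cruxes/MonotoneBlind/STRATEGY-CENSUS.md`. Everything here ELABORATES; nothing is `sorry`; the open statements are
`def … : Prop` (typed signatures of the census), the proved items are bookkeeping only.

Contents.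

* §0 `MonotoneBlindAt δ`, `MonotoneSufficesAt δ` — the two cruxes at ONE exponent; `monotoneBlind_iff_forall_at`,
  `monotoneBlindAt_of_monotoneBlind`; and `closes_at` — the route's deciding theorem re-proved from the two cruxes
  AT A SINGLE `δ₀ ∈ (0, 1/2)` (the filed `closes` instantiates both `∀ δ` cruxes at `δ = 1/4` only). Census finding D0:
  the filed crux is pinned to its hardest end `δ → 0⁺` (`DeltaMonotone`, §1) while the route consumes one `δ₀`.
* §1 `DeltaMonotone` — detection at clique exponent `1/2 - δ₁` implies detection at every `1/2 - δ₂ ≥ 1/2 - δ₁`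
  (planting a larger clique dominates planting a smaller one; monotone circuits accept more). Provable-now (M).
* §2 Transfer T1: `LargeKSparseDose` — the `k = ⌈n^{1/2-δ}⌉` form of the in-tree relative sparse-dose theorem
  (`thm1_sparse_relative` is stated for CONSTANT `k`; the finite dichotomy `thm1_sparse_finite` allows every `k ≤ n`).
* §3 Transfer T2 / Decomposition D1: `BareBlindAt` (Błasiok–Meierhöfer 2025, arXiv:2501.09545 Thm 1.3 with
  `α - 1 = 2 log₂ n`, i.e. `p = 1/2`: bare `β`-cliques, `β = n^{1/2-δ}`, versus `G(n,1/2)` need monotone size `n^{ω(1)}`)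
  and `NoiseLift` (monotone noise removal); glue `monotoneBlindAt_of_bareBlind_noiseLift` (proved, trivial seam).
* §4 Strengthen S1: `RateBlindAt` (polynomial-rate advantage bound, the form a hybrid argument needs).
-/

set_option linter.dupNamespace false

namespace Summit.PneNP.PneNP.Cruxes.MonotoneBlind.StrategyCensus

open Literature.Computability.Complexity Literature.Probability.RandomGraphs.PlantedClique Filter Finset
open Summit.PneNP.PneNP.Theses.KarlinRubin

/-! ## §0 The cruxes at one exponent, and the deciding theorem at one exponent -/

/-- A monotone `{∧₂,∨₂,0,1}`-family of size `≤ n^c` (eventually) strongly detects the planted `⌈n^{1/2-δ}⌉`-clique in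
`G(n,1/2)`: exactly the existential negated inside `MonotoneBlind`. [folklore] -/
def DetectsMono (δ : ℝ) (c : ℕ) (C : (n : ℕ) → Circuit ((⊤ : SimpleGraph (Fin n)).edgeSet)) : Prop :=
  (∀ᶠ n : ℕ in atTop, (C n).IsOver monotoneBasis01 ∧ (C n).size ≤ n ^ c) ∧
    Tendsto (fun n : ℕ => (erdosRenyiHalf n).toOuterMeasure {x | (C n).eval x = true} +
      (plantedCliqueDist n ⌈(n : ℝ) ^ (1 / 2 - δ)⌉₊).toOuterMeasure {x | (C n).eval x = false})
      atTop (nhds 0)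

/-- `MonotoneBlind` at ONE clique exponent `1/2 - δ`. [folklore] -/
def MonotoneBlindAt (δ : ℝ) : Prop :=
  ∀ c : ℕ, ¬ ∃ C : (n : ℕ) → Circuit ((⊤ : SimpleGraph (Fin n)).edgeSet), DetectsMono δ c C

/-- `MonotoneSuffices` at ONE clique exponent `1/2 - δ`. [folklore] -/
def MonotoneSufficesAt (δ : ℝ) : Prop :=
  ∃ a : ℕ, ∀ s : ℕ → ℕ,
    (∃ C : (n : ℕ) → Circuit ((⊤ : SimpleGraph (Fin n)).edgeSet),
      (∀ᶠ n : ℕ in atTop, (C n).IsOver B2 ∧ (C n).size ≤ s n) ∧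
        Tendsto (fun n : ℕ => (erdosRenyiHalf n).toOuterMeasure {x | (C n).eval x = true} +
          (plantedCliqueDist n ⌈(n : ℝ) ^ (1 / 2 - δ)⌉₊).toOuterMeasure {x | (C n).eval x = false})
          atTop (nhds 0)) →
    ∃ C' : (n : ℕ) → Circuit ((⊤ : SimpleGraph (Fin n)).edgeSet),
      (∀ᶠ n : ℕ in atTop, (C' n).IsOver monotoneBasis01 ∧ (C' n).size ≤ (s n + n) ^ a) ∧
        Tendsto (fun n : ℕ => (erdosRenyiHalf n).toOuterMeasure {x | (C' n).eval x = true} +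
          (plantedCliqueDist n ⌈(n : ℝ) ^ (1 / 2 - δ)⌉₊).toOuterMeasure {x | (C' n).eval x = false})
          atTop (nhds 0)

/-- The filed crux is the conjunction of its one-exponent instances. [folklore] -/
theorem monotoneBlind_iff_forall_at :
    MonotoneBlind ↔ ∀ δ : ℝ, 0 < δ → δ < 1 / 2 → MonotoneBlindAt δ := Iff.rfl

/-- The filed crux gives every one-exponent instance. [folklore] -/
theorem monotoneBlindAt_of_monotoneBlind (h : MonotoneBlind) {δ : ℝ} (h0 : 0 < δ) (h1 : δ < 1 / 2) :
    MonotoneBlindAt δ := h δ h0 h1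

/-- The filed `MonotoneSuffices` gives every one-exponent instance. [folklore] -/
theorem monotoneSufficesAt_of_monotoneSuffices (h : MonotoneSuffices) {δ : ℝ} (h0 : 0 < δ) (h1 : δ < 1 / 2) :
    MonotoneSufficesAt δ := h δ h0 h1

/-- **Census D0 — the deciding theorem needs the two cruxes at ONE exponent only.** For every `δ₀ ∈ (0,1/2)`,
`MonotoneSufficesAt δ₀ → MonotoneBlindAt δ₀ → ErdosRenyiNoLargeClique → CliqueCircuitsOfNotPneNP → PneNP`; the proof
is the route's `closes` verbatim with `1/4` replaced by `δ₀` (the clique size `t(n) = 3⌊log₂ n⌋ + 3` is `≤ ⌈n^{1/2-δ₀}⌉`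
eventually for every `δ₀ < 1/2`, `tLog_le_eventually`). Consequence for planning: restating both cruxes at a fixed
`δ₀` (e.g. `δ₀ = 1/4`, or `δ₀` close to `1/2`, i.e. planted cliques of size `n^ε`) is a strict weakening of the pair that
still closes the route, whereas the filed `∀ δ` form of `MonotoneBlind` is as hard as its `δ → 0⁺` end (§1). [folklore] -/
theorem closes_at {δ₀ : ℝ} (hδ0 : 0 < δ₀) (hδ1 : δ₀ < 1 / 2) (hSim : MonotoneSufficesAt δ₀)
    (hLB : MonotoneBlindAt δ₀) (hE : ErdosRenyiNoLargeClique) (hBridge : CliqueCircuitsOfNotPneNP) : PneNP := by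
  classical
  by_contra hne
  -- (1) polynomial B₂-circuits for the clique functions, from the bridge
  obtain ⟨c₁, hc₁⟩ := hBridge hne
  -- (2) the clique size `t n = 3 ⌊log₂ n⌋ + 3`
  let t : ℕ → ℕ := fun n => 3 * Nat.log 2 n + 3
  have ht_logb : ∀ n : ℕ, (2 + 1) * Real.logb 2 (n : ℝ) ≤ (t n : ℝ) :=
    Summit.PneNP.PneNP.Theorems.MonotoneBlind.Negative.three_logb_le_tLog
  have hgrow : ∀ᶠ n : ℕ in Filter.atTop, t n ≤ ⌈(n : ℝ) ^ (1 / 2 - δ₀ : ℝ)⌉₊ ∧ t n ≤ n :=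
    Summit.PneNP.PneNP.Theorems.MonotoneBlind.Negative.tLog_le_eventually (ε := 1 / 2 - δ₀)
      (by linarith) (by linarith)
  -- (3) the circuit family (junk outside the eventual range)
  let F : (n : ℕ) → (((⊤ : SimpleGraph (Fin n)).edgeSet → Bool) → Bool) := fun n x =>
    decide (¬ (SimpleGraph.fromEdgeSet {e : Sym2 (Fin n) | ∃ h : e ∈ (⊤ : SimpleGraph (Fin n)).edgeSet, x ⟨e, h⟩ = true}).CliqueFree (t n))
  let P : (n : ℕ) → Prop := fun n =>
    ∃ C : Literature.Computability.Complexity.Circuit ((⊤ : SimpleGraph (Fin n)).edgeSet),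
      C.IsOver Literature.Computability.Complexity.B2 ∧ C.size ≤ n ^ c₁ ∧ C.Computes (F n)
  let C : (n : ℕ) → Literature.Computability.Complexity.Circuit ((⊤ : SimpleGraph (Fin n)).edgeSet) :=
    fun n => if h : P n then h.choose else Literature.Computability.Complexity.Circuit.const _ false
  have hCP : ∀ᶠ n : ℕ in Filter.atTop, (C n).IsOver Literature.Computability.Complexity.B2 ∧
      (C n).size ≤ n ^ c₁ ∧ (C n).Computes (F n) := by
    filter_upwards [hc₁, hgrow] with n hn hg
    have hP : P n := hn (t n) hg.2
    have hC : C n = hP.choose := dif_pos hP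
    rw [hC]
    exact hP.choose_spec
  -- the circuit accepts exactly the graphs with a `t n`-clique
  have hevT : ∀ n : ℕ, (C n).Computes (F n) → ∀ x, (C n).eval x = true ↔
      ∃ S : Finset (Fin n), S.card = t n ∧
        (Literature.Probability.RandomGraphs.PlantedClique.graphOfEdgeVec x).IsClique (S : Set (Fin n)) := by
    intro n hn x
    rw [hn x]
    simp only [F, decide_eq_true_eq, SimpleGraph.CliqueFree, not_forall, not_not]
    constructor
    · rintro ⟨S, hS⟩
      exact ⟨S, hS.card_eq, hS.isClique⟩
    · rintro ⟨S, h1, h2⟩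
      exact ⟨S, ⟨h2, h1⟩⟩
  -- (4a) type-I error → 0 (first-moment bound `hE`)
  have hI : Filter.Tendsto (fun n : ℕ =>
      (Literature.Probability.RandomGraphs.PlantedClique.erdosRenyiHalf n).toOuterMeasure {x | (C n).eval x = true})
      Filter.atTop (nhds 0) := by
    have hE' := hE t ⟨1, one_pos, Filter.Eventually.of_forall ht_logb⟩
    refine hE'.congr' ?_
    filter_upwards [hCP] with n hn
    congr 1
    ext x
    simp only [Set.mem_setOf_eq]
    exact (hevT n hn.2.2 x).symm
  -- (4b) type-II error = 0 eventually (the planted clique contains a `t n`-clique)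
  have hII : ∀ᶠ n : ℕ in Filter.atTop,
      (Literature.Probability.RandomGraphs.PlantedClique.plantedCliqueDist n ⌈(n : ℝ) ^ (1 / 2 - δ₀ : ℝ)⌉₊).toOuterMeasure
        {x | (C n).eval x = false} = 0 := by
    filter_upwards [hCP, hgrow] with n hn hg
    rw [PMF.toOuterMeasure_apply_eq_zero_iff, Set.disjoint_left]
    intro x hx hxf
    rw [Literature.Probability.RandomGraphs.PlantedClique.plantedCliqueDist, PMF.support_map] at hx
    obtain ⟨p, hp, rfl⟩ := hx
    obtain ⟨hcard, hcl⟩ := Literature.Probability.RandomGraphs.PlantedClique.mem_support_plantedCliqueJoint hp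
    have hle : t n ≤ p.1.card := by rw [hcard]; exact le_min hg.1 hg.2
    obtain ⟨S, hSsub, hScard⟩ := Finset.exists_subset_card_eq hle
    have hclS : (Literature.Probability.RandomGraphs.PlantedClique.graphOfEdgeVec p.2).IsClique (S : Set (Fin n)) :=
      hcl.subset (by exact_mod_cast hSsub)
    have htrue : (C n).eval p.2 = true := (hevT n hn.2.2 p.2).2 ⟨S, hScard, hclS⟩
    simp only [Set.mem_setOf_eq] at hxf
    rw [htrue] at hxf
    exact Bool.noConfusion hxf
  have hsum : Filter.Tendsto (fun n : ℕ =>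
      (Literature.Probability.RandomGraphs.PlantedClique.erdosRenyiHalf n).toOuterMeasure {x | (C n).eval x = true}
        + (Literature.Probability.RandomGraphs.PlantedClique.plantedCliqueDist n ⌈(n : ℝ) ^ (1 / 2 - δ₀ : ℝ)⌉₊).toOuterMeasure
            {x | (C n).eval x = false}) Filter.atTop (nhds 0) := by
    refine hI.congr' ?_
    filter_upwards [hII] with n hn
    rw [hn, add_zero]
  -- (5) monotone simulation, then the monotone lower bound
  obtain ⟨a, ha⟩ := hSim
  obtain ⟨C', hC', hT'⟩ := ha (fun n => n ^ c₁) ⟨C, hCP.mono fun n h => ⟨h.1, h.2.1⟩, hsum⟩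
  have hpow : ∀ n : ℕ, 2 ≤ n → (n ^ c₁ + n) ^ a ≤ n ^ (a * (c₁ + 2)) := by
    intro n hn
    have hpos : 0 < n := by omega
    have h1 : n ^ c₁ ≤ n ^ (c₁ + 1) := Nat.pow_le_pow_right hpos (Nat.le_succ c₁)
    have h2 : n ≤ n ^ (c₁ + 1) := by
      calc n = n ^ 1 := (pow_one n).symm
        _ ≤ n ^ (c₁ + 1) := Nat.pow_le_pow_right hpos (by omega)
    have h3 : n ^ c₁ + n ≤ n ^ (c₁ + 2) := by
      calc n ^ c₁ + n ≤ n ^ (c₁ + 1) + n ^ (c₁ + 1) := Nat.add_le_add h1 h2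
        _ = 2 * n ^ (c₁ + 1) := by ring
        _ ≤ n * n ^ (c₁ + 1) := Nat.mul_le_mul_right _ hn
        _ = n ^ (c₁ + 2) := by ring
    calc (n ^ c₁ + n) ^ a ≤ (n ^ (c₁ + 2)) ^ a := Nat.pow_le_pow_left h3 a
      _ = n ^ (a * (c₁ + 2)) := by rw [← pow_mul, mul_comm]
  refine hLB (a * (c₁ + 2)) ⟨C', ?_, hT'⟩
  filter_upwards [hC', Filter.eventually_ge_atTop 2] with n hn h2
  exact ⟨hn.1, hn.2.trans (hpow n h2)⟩

/-! ## §1 Monotonicity in the clique exponent -/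

/-- **Census D0'.** Detection is monotone in the clique size: if a monotone family of size `≤ n^c` strongly detects the
planted `⌈n^{1/2-δ₁}⌉`-clique, the SAME family strongly detects the planted `⌈n^{1/2-δ₂}⌉`-clique for every
`δ₂ ≤ δ₁` (a uniformly random `k₂`-set contains a uniformly random `k₁`-set, planting more edges can only raise a
monotone circuit's output, so the type-II error does not increase; the type-I error is unchanged). Hence
`MonotoneBlindAt δ₂ → MonotoneBlindAt δ₁` for `δ₂ ≤ δ₁`, and the filed `∀ δ` crux is equivalent to
`∀ m, MonotoneBlindAt (1/(m+3))`-type statements at the `δ → 0⁺` end — its hardest instances. Provable now (M):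
needs the PMF coupling `(uniform k₂-subsets).bind (uniform k₁-subsets of it) = uniform k₁-subsets` and
`Circuit.monotone_eval_of_isOver_monotoneBasis01`. [folklore] -/
def DeltaMonotone : Prop :=
  ∀ δ₁ δ₂ : ℝ, 0 < δ₂ → δ₂ ≤ δ₁ → δ₁ < 1 / 2 → ∀ c : ℕ,
    ∀ C : (n : ℕ) → Circuit ((⊤ : SimpleGraph (Fin n)).edgeSet), DetectsMono δ₁ c C → DetectsMono δ₂ c C

/-- With `DeltaMonotone`, blindness at a smaller `δ` (larger clique) gives blindness at every larger `δ`. [folklore] -/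
theorem monotoneBlindAt_mono (hD : DeltaMonotone) {δ₁ δ₂ : ℝ} (h0 : 0 < δ₂) (h12 : δ₂ ≤ δ₁) (h1 : δ₁ < 1 / 2)
    (h : MonotoneBlindAt δ₂) : MonotoneBlindAt δ₁ :=
  fun c ⟨C, hC⟩ => h c ⟨C, hD δ₁ δ₂ h0 h12 h1 c C hC⟩

/-- With `DeltaMonotone`, the filed crux follows from its instances along ANY sequence `δ_m → 0⁺`. [folklore] -/
theorem monotoneBlind_of_seq (hD : DeltaMonotone) (d : ℕ → ℝ) (hd0 : ∀ m, 0 < d m)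
    (hsmall : ∀ δ : ℝ, 0 < δ → ∃ m, d m ≤ δ) (h : ∀ m, MonotoneBlindAt (d m)) : MonotoneBlind := by
  intro δ hδ0 hδ1
  obtain ⟨m, hm⟩ := hsmall δ hδ0
  exact monotoneBlindAt_mono hD (hd0 m) hm hδ1 (h m)

/-! ## §2 Transfer T1 — the large-`k` relative sparse dose (first lemma of the Rossman transfer) -/

/-- **T1 first lemma (signature).** For every size exponent `c` and clique exponent `1/2 - δ` there is a sprinkle
exponent `ρ > 0` such that, eventually in `n`, for EVERY monotone circuit of size `≤ n^c` and EVERY background graph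
`x`: `Pr_A[C(x ∪ K_A) = 1] ≤ η + Pr_{y ∼ G(n, n^{-ρ})}[C(x ∪ y) = 1]`, `A` a uniformly random `⌈n^{1/2-δ}⌉`-set
("a planted `n^{1/2-δ}`-clique is worth at most one `n^{-ρ}`-dose, on top of any background"). The in-tree
`thm1_sparse_relative` is this for CONSTANT `k`; for `k = ⌈n^{1/2-δ}⌉` rerun the finite dichotomy `thm1_sparse_finite`
(valid for all `5 ≤ k' ≤ k ≤ n`) with class parameter `k' ≈ 4(c+2)/δ` and `ρ < min (2δ, 1/k')`: the fibre factor is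
`(k/n)^v = n^{-(1/2+δ)v}` instead of `n^{-v}` (census §T1 for the exponent bookkeeping). Provable now (M–L). The census
shows WHY it has no teeth on the crux (abstract counter-model). [cite: Rossman2010, Thm 1; variant] -/
def LargeKSparseDose (c : ℕ) (δ : ℝ) : Prop :=
  ∃ ρ : ℝ, 0 < ρ ∧ ∀ η : ℝ, 0 < η →
    ∀ᶠ n : ℕ in atTop, ∀ C : Circuit ((⊤ : SimpleGraph (Fin n)).edgeSet),
      C.IsOver monotoneBasis01 → C.size ≤ n ^ c →
      ∀ x : (⊤ : SimpleGraph (Fin n)).edgeSet → Bool,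
        kSubsetProb n ⌈(n : ℝ) ^ (1 / 2 - δ)⌉₊ (fun A => C.eval (x ⊔ cliqueVec A) = true) ≤
          η + gnpProb n ((n : ℝ) ^ (-ρ)) (univ.filter fun y => C.eval (x ⊔ y) = true)

/-! ## §3 Transfer T2 / Decomposition D1 — bare cliques (BM25) and monotone noise removal -/

/-- A monotone `≤ n^c` family separates BARE `⌈n^{1/2-δ}⌉`-cliques from `G(n,1/2)` with vanishing error:
`Pr_{G(n,1/2)}[C = 1] → 0` and `Pr_A[C(K_A) = 0] → 0`. [cite: arXiv:2501.09545, Def 1.2] -/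
def SeparatesBare (δ : ℝ) (c : ℕ) (C : (n : ℕ) → Circuit ((⊤ : SimpleGraph (Fin n)).edgeSet)) : Prop :=
  (∀ᶠ n : ℕ in atTop, (C n).IsOver monotoneBasis01 ∧ (C n).size ≤ n ^ c) ∧
    Tendsto (fun n : ℕ => (erdosRenyiHalf n).toOuterMeasure {x | (C n).eval x = true}) atTop (nhds 0) ∧
    Tendsto (fun n : ℕ => kSubsetProb n ⌈(n : ℝ) ^ (1 / 2 - δ)⌉₊ (fun A => (C n).eval (cliqueVec A) = false))
      atTop (nhds 0)

/-- **T2: bare blindness** — Błasiok–Meierhöfer 2025, Thm 1.3 at `α - 1 = 2 log₂ n` (`p = n^{-2/(α-1)} = 1/2`),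
`β = n^{1/2-δ}` (so `αβ < n^{1-δ'}/log n` for every `δ' < 1/2 + δ`): monotone circuits rejecting `G(n,1/2)` and
accepting a bare `β`-clique have size `n^{Ω(δ'²α)} = n^{Ω(log n)}`; even the Erdős–Rado instantiation of their
Thm 1.14 (Lemma 1.10) gives `n^{ω(1)}`. A THEOREM IN PRINT, not in the tree (L–XL to vendor over
`CliqueApproximators` + `exists_quasiSunflower`). [cite: arXiv:2501.09545, Thm 1.3] -/
def BareBlindAt (δ : ℝ) : Prop :=
  ∀ c : ℕ, ¬ ∃ C : (n : ℕ) → Circuit ((⊤ : SimpleGraph (Fin n)).edgeSet), SeparatesBare δ c C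

/-- **D1 hard half: monotone noise removal (signature).** A poly-size monotone strong detector of NOISY planted
cliques (`G(n,1/2) ∪ K_A` vs `G(n,1/2)`) yields a poly-size monotone separator of BARE cliques from `G(n,1/2)`
(possibly at another exponent `δ'`). No mechanism is known: every restriction / monotone projection trades clique
density against background density (census §D1); given `BareBlindAt δ'` (a theorem in print) it is EQUIVALENT to
`MonotoneBlindAt δ` — recorded as the best typed split, NOT filed. [folklore] -/
def NoiseLift (δ δ' : ℝ) : Prop :=
  ∀ c : ℕ, (∃ C : (n : ℕ) → Circuit ((⊤ : SimpleGraph (Fin n)).edgeSet), DetectsMono δ c C) →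
    ∃ c' : ℕ, ∃ C' : (n : ℕ) → Circuit ((⊤ : SimpleGraph (Fin n)).edgeSet), SeparatesBare δ' c' C'

/-- The D1 seam (modus tollens). [folklore] -/
theorem monotoneBlindAt_of_bareBlind_noiseLift {δ δ' : ℝ} (hB : BareBlindAt δ') (hL : NoiseLift δ δ') :
    MonotoneBlindAt δ := by
  intro c hC
  obtain ⟨c', C', hC'⟩ := hL c hC
  exact hB c' ⟨C', hC'⟩

/-! ## §4 Strengthen S1 — a polynomial RATE (the form a hybrid / telescoping argument needs) -/

/-- **S1 (signature).** Advantage at a polynomial rate: for every `c` there is `ε > 0` such that every monotone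
`≤ n^c` family has `Pr_{planted}[C = 1] ≤ Pr_{G(n,1/2)}[C = 1] + n^{-ε}` eventually. Strictly stronger than
`MonotoneBlindAt δ` (which only forbids error sum `→ 0`); it is what a telescoping over the `k` planted vertices (or
over intra-clique density) needs, each step then being a NOISY-positive statement of the same kind (census §S1–S3:
the uniform per-step version is FALSE — common-neighbourhood circuits). [folklore] -/
def RateBlindAt (δ : ℝ) : Prop :=
  ∀ c : ℕ, ∃ ε : ℝ, 0 < ε ∧ ∀ C : (n : ℕ) → Circuit ((⊤ : SimpleGraph (Fin n)).edgeSet),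
    (∀ᶠ n : ℕ in atTop, (C n).IsOver monotoneBasis01 ∧ (C n).size ≤ n ^ c) →
      ∀ᶠ n : ℕ in atTop,
        (plantedCliqueDist n ⌈(n : ℝ) ^ (1 / 2 - δ)⌉₊).toOuterMeasure {x | (C n).eval x = true} ≤
          (erdosRenyiHalf n).toOuterMeasure {x | (C n).eval x = true} + ENNReal.ofReal ((n : ℝ) ^ (-ε))

end Summit.PneNP.PneNP.Cruxes.MonotoneBlind.StrategyCensus
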